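import Summits.BirchSwinnertonDyer.BirchSwinnertonDyer.Theorems.KolyvaginDepthDoorKolyvaginDepthSupplyDoorOfSystemReading
import Literature.NumberTheory.EllipticCurves.McCallum1991.KolyvaginClassesLocalLeaves
import HarnessLib

/-!
# Route `KolyvaginDepthDoor`, crux `KolyvaginDepthSupply` (stmt-BirchSwinnertonDyer-21765) —
# the depth-table row without Kolyvagin's structure theorem, EVERY Euler-system input BY NAME

Helper file (`--supports stmt-BirchSwinnertonDyer-21765 --as helper`); it closes nothing and BSD is
not proved by it.

`…KolyvaginDepthSupplyDoorOfSystem(Reading)` runs Kolyvagin's minimal-depth descent on the crux's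
objects with the local inputs as displayed hypotheses (`hτc`, `hfin`, `hinf`, `h44`, `hcyc`,
`hdual`). Here each of them is DISCHARGED BY NAME from the tree's McCallum 1991 facts for the
concrete classes `KolyvaginHeegnerData.kolyvaginClass` (all at level `p^M`, here `M = 1`):

| hypothesis | named fact (`Literature.NumberTheory.EllipticCurves.McCallum1991.…`) | print |
|---|---|---|
| `hτc` | `sign_conjAct_kolyvaginClass` | Gross 1991 Prop. 5.4 (2) / McCallum §5 |
| `hfin`, `hinf` | `lemma43_kolyvaginClass_mem_selmerLocalKer` | McCallum Lemma 4.3 / Gross Prop. 6.2 (1) |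
| `h44` | `prop44_localOrder_kolyvaginClass_mul_eq` (via the tree's `kolyvaginClass_mul_mem_*_of_prop44`) | McCallum Prop. 4.4 |
| `hcyc` | `lemma53_selmer_eigen_dependent_at` | McCallum Lemma 5.3 / Gross Prop. 8.1 (1) |
| `hdual` | `prop22_reciprocity_eigen_finset` (via `mem_selmerLocalKer_of_not_mem_torsionLocalKer_of_prop22`) | McCallum Prop. 2.2 + Lemma 5.3 |

The price of naming `h44` is McCallum's ONE SYSTEM OF CHOICES: the data `d n` must be COMPATIBLE
along `K_m ⊆ K_{mℓ} ⊆ ℂ` (the generators `σ_{ℓ'}`, the coset representatives `S` and the embedding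
into `K̄` restrict; hypotheses `hσ`, `hS₁`, `hS₂`, `hemb`, verbatim the binders of the Prop. 4.4
fact).

* `shaCorank_eq_zero_of_rank_two_of_kolyvaginClass_prime_ne_zero_of_print` — **the rank-2 row
  certificate without `hF`**: for a compatible system `d` of Kolyvagin–Heegner data over a frame
  `(Dt, β, ι)` of a non-CM globally minimal `E/ℚ` and a Heegner field `K` (`d_K ∉ {−3, −4}`), an odd
  prime `p` with `ρ̄_{E,p^n}` onto for all `n`, ONE Kolyvagin prime `ℓ` (Zhang's congruence form)
  with the bit `(d ℓ).kolyvaginClass hp 1 ≠ 0`, two independent points on `E(ℚ)` and one point of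
  infinite order on `E^{(d_K)}(ℚ)`: `corank_{ℤ_p} Ш(E/ℚ)[p^∞] = 0`, `rank E(ℚ) = 2`,
  `rank E^{(d_K)}(ℚ) = 1`, `corank Ш(E^{(d_K)}/ℚ)[p^∞] = 0` — CONDITIONAL on exactly the five
  named facts of the table (trust base: Gross §§5–6, McCallum §§2–5; sizes S–M; Kolyvagin 1991
  Thm. 4 is NOT among them), the compatible system, and the point certificates.

References: [McCallumLMS1991] §§2–5; [GrossLMS1991] §§5–8, §10; [Kolyvagin1991MathAnn] Thm. 2.3;
[JetchevLauterStein2009] §3.6.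
-/

set_option linter.dupNamespace false

noncomputable section

open scoped Classical

namespace Summit.BirchSwinnertonDyer.BirchSwinnertonDyer.Theorems.KolyvaginDepthDoor

open Literature.NumberTheory.EllipticCurves Literature.NumberTheory.EllipticCurves.ModularForms
  Literature.NumberTheory.EllipticCurves.McCallum1991 WeierstrassCurve NumberField IsDedekindDomain

section Print

variable {W : WeierstrassCurve ℚ} [W.IsElliptic] [W.IsGloballyMinimal] [NeZero (W.conductorNorm ℤ)]
  {K : Type} [Field K] [NumberField K]
  {Dt : ModularParametrizationData W (W.conductorNorm ℤ)} {β : ℤ} {ι : K →+* ℂ}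

/-- **The depth-table row without Kolyvagin's structure theorem, all Euler-system inputs named.**
`E/ℚ` globally minimal without CM, `K` imaginary quadratic with `d_K ∉ {−3, −4}` and the Heegner
hypothesis for `N_E`, `c` its complex conjugation, `p` an odd prime with `ρ̄_{E,p^n}` onto for all
`n`, a frame `(Dt, β, ι)` and a COMPATIBLE system `d n : KolyvaginHeegnerData Dt β ι n`
(`hσ`, `hS₁`, `hS₂`, `hemb`: McCallum's one system of choices). Granted the named facts
`sign_conjAct_kolyvaginClass` (Gross Prop. 5.4 (2)), `lemma43_kolyvaginClass_mem_selmerLocalKer`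
(McCallum Lemma 4.3), `prop44_localOrder_kolyvaginClass_mul_eq` (Prop. 4.4),
`lemma53_selmer_eigen_dependent_at` (Lemma 5.3), `prop22_reciprocity_eigen_finset` (Prop. 2.2): ONE
Kolyvagin prime `ℓ` with `(d ℓ).kolyvaginClass hp 1 ≠ 0`, `2 ≤ rank E(ℚ)` and
`1 ≤ rank E^{(d_K)}(ℚ)` give `corank_{ℤ_p} Ш(E/ℚ)[p^∞] = 0`, `rank E(ℚ) = 2`, `rank E^{(d_K)}(ℚ) = 1`,
`corank_{ℤ_p} Ш(E^{(d_K)}/ℚ)[p^∞] = 0` (Kolyvagin's minimal-depth descent,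
`shaCorank_eq_zero_of_rank_two_of_kolyvaginClass_prime_ne_zero_of_system`, with McCallum's Cor. 3.2
a tree theorem). CONDITIONAL on the five named facts; per-curve; BSD is not proved by it.
[cite: Kolyvagin1991MathAnn, Thm. 2.3] [cite: McCallumLMS1991, §§2–5]
[cite: GrossLMS1991, §10] -/
theorem shaCorank_eq_zero_of_rank_two_of_kolyvaginClass_prime_ne_zero_of_print
    (h54 : sign_conjAct_kolyvaginClass) (h43 : lemma43_kolyvaginClass_mem_selmerLocalKer)
    (h44 : prop44_localOrder_kolyvaginClass_mul_eq) (h53 : lemma53_selmer_eigen_dependent_at)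
    (h22 : prop22_reciprocity_eigen_finset)
    (hcm : ¬ W.HasCM) (hK : IsImaginaryQuadratic K) (hD3 : NumberField.discr K ≠ -3)
    (hD4 : NumberField.discr K ≠ -4) (hH : SatisfiesHeegnerHypothesis (W.conductorNorm ℤ) K)
    (p : ℕ) [hp : Fact p.Prime] (hp2 : p ≠ 2)
    (htower : ∀ n : ℕ, W.HasSurjectiveModNGaloisRep (p ^ n : ℕ))
    (c : K ≃ₐ[ℚ] K) (hc : c ≠ 1) (hcc : c * c = 1)
    (d : ∀ n : ℕ, KolyvaginHeegnerData Dt β ι n)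
    (hσ : ∀ (m l : ℕ), ∀ l' ∈ m.primeFactors, ∀ (x : ringClassField K ι m)
      (x' : ringClassField K ι (m * l)),
      (x : ℂ) = x' → (((d (m * l)).σ l' x' : ringClassField K ι (m * l)) : ℂ) = ((d m).σ l' x : ℂ))
    (hS₁ : ∀ (m l : ℕ), ∀ s ∈ (d m).S, ∃ s' ∈ (d (m * l)).S, ∀ (x : ringClassField K ι m)
      (x' : ringClassField K ι (m * l)),
      (x : ℂ) = x' → ((s' x' : ringClassField K ι (m * l)) : ℂ) = (s x : ℂ))
    (hS₂ : ∀ (m l : ℕ), ∀ s' ∈ (d (m * l)).S, ∃ s ∈ (d m).S, ∀ (x : ringClassField K ι m)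
      (x' : ringClassField K ι (m * l)),
      (x : ℂ) = x' → ((s' x' : ringClassField K ι (m * l)) : ℂ) = (s x : ℂ))
    (hemb : ∀ (m l : ℕ) (x : ringClassField K ι m) (x' : ringClassField K ι (m * l)),
      (x : ℂ) = x' → (d (m * l)).emb x' = (d m).emb x)
    {ℓ : ℕ} (hℓ : Zhang2014.IsKolyvaginPrime (W.conductorNorm ℤ) W K p ℓ)
    (hne : (d ℓ).kolyvaginClass hp.out 1 ≠ 0) (h2 : 2 ≤ W.mordellWeilRank)
    (h1 : 1 ≤ (W.quadraticTwist (NumberField.discr K : ℚ)).mordellWeilRank) :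
    W.shaCorank p = 0 ∧ W.mordellWeilRank = 2 ∧
      (W.quadraticTwist (NumberField.discr K : ℚ)).mordellWeilRank = 1 ∧
      (W.quadraticTwist (NumberField.discr K : ℚ)).shaCorank p = 0 := by
  -- `ℓ' ∈ S₁(1)` for every Kolyvagin prime (Zhang's `0 < M(ℓ')`)
  have hS1 : ∀ {n : ℕ}, (∀ q ∈ n.primeFactors, Zhang2014.IsKolyvaginPrime (W.conductorNorm ℤ) W K p q) →
      ∀ q ∈ n.primeFactors, Zhang2014.IsKolyvaginPrime (W.conductorNorm ℤ) W K p q ∧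
        1 ≤ Zhang2014.kolyvaginIndex W p q :=
    fun h q hq ↦ ⟨h q hq, (h q hq).2.2.2.2.2⟩
  -- the sign law (Gross Prop. 5.4 (2))
  obtain ⟨ε, hε, hsign⟩ := h54 W hcm K hK hD3 hD4 hH p hp2 htower c hc Dt β ι 1 le_rfl
  refine shaCorank_eq_zero_of_rank_two_of_kolyvaginClass_prime_ne_zero_of_system hcm hK p hp2 htower
    c hc hcc d ε hε (fun n hn hk ↦ hsign n hn (hS1 hk) (d n))
    (fun n hn hk v hv ↦ (h43 W hcm K hK hD3 hD4 hH p hp2 htower Dt β ι 1 le_rfl n hn (hS1 hk)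
      (d n)).1 v hv)
    (fun n hn hk w ↦ (h43 W hcm K hK hD3 hD4 hH p hp2 htower Dt β ι 1 le_rfl n hn (hS1 hk)
      (d n)).2 w)
    (fun l m hsq hk hl v hv ↦ ?_)
    (fun l hl e he s₁ hs₁ hτ₁ s₂ hs₂ hτ₂ ↦ h53 W hcm K hK p hp2 htower c hc 1 le_rfl l hl
      hl.2.2.2.2.2 e he s₁ hs₁ hτ₁ s₂ hs₂ hτ₂)
    (fun T hT l hlT e he x hx hoff hinf s hs hτs hsT v hv hsv ↦
      mem_selmerLocalKer_of_not_mem_torsionLocalKer_of_prop22 h22 W hcm K hK p hp2 htower c hc T hT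
        hlT e he x hx hoff hinf s hs hτs hsT v hv hsv)
    hℓ hne h2 h1
  -- `h44`: McCallum Prop. 4.4 "in particular" for the compatible pair `(d m, d (m l))`
  have hsq' : Squarefree (m * l) := by rwa [Nat.mul_comm] at hsq
  have hk' : ∀ q ∈ (m * l).primeFactors, Zhang2014.IsKolyvaginPrime (W.conductorNorm ℤ) W K p q ∧
      1 ≤ Zhang2014.kolyvaginIndex W p q := by
    rw [Nat.mul_comm]
    exact hS1 hk
  have hlm : ¬ l ∣ m := by
    intro hdiv
    have hll : l * l ∣ l * m := Nat.mul_dvd_mul_left l hdiv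
    exact hl.1.not_isUnit (hsq l hll)
  have hA := kolyvaginClass_mul_mem_selmerLocalKer_iff_of_prop44 h44 W hcm K hK hD3 hD4 hH p hp2
    htower Dt β ι 1 le_rfl m l hsq' hl.1 hlm hk' (d m) (d (m * l)) (hσ m l) (hS₁ m l) (hS₂ m l)
    (hemb m l) v hv
  have hB := kolyvaginClass_mul_mem_torsionLocalKer_iff_of_prop44 h44 W hcm K hK hD3 hD4 hH p hp2
    htower Dt β ι 1 le_rfl m l hsq' hl.1 hlm hk' (d m) (d (m * l)) (hσ m l) (hS₁ m l) (hS₂ m l)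
    (hemb m l) v hv
  have hAB : (d (m * l)).kolyvaginClass (Fact.out : p.Prime) 1 ∈
        selmerLocalKer (W.baseChange K) (v.adicCompletion K) ((p ^ 1 : ℕ) : ℤ) ↔
      (d m).kolyvaginClass (Fact.out : p.Prime) 1 ∈
        (W.baseChange K).torsionLocalKer (v.adicCompletion K) ((p ^ 1 : ℕ) : ℤ) := hA.trans hB
  rw [Nat.mul_comm m l] at hAB
  exact hAB

end Print

end Summit.BirchSwinnertonDyer.BirchSwinnertonDyer.Theorems.KolyvaginDepthDoor

end
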